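import Literature.AnabelianGeometry.EtaleTheta.LogDivisorTower
import Literature.AnabelianGeometry.EtaleTheta.DivisorMonoidsRootLaw
import Literature.AnabelianGeometry.EtaleTheta.Discharge.Sec3RootLawNoGoTempered

/-!
# [EtTh] Def. 3.3 (iii) v2, part C: E2 (a) on the tower datum — `RootLaw (ofTower T)` unfolded, and agreement of the
# one-level tower with the tempered model of record

S. Mochizuki, *The étale theta function …*, Publ. RIMS **45** (2009) [MochizukiEtTh2009], §3 Def. 3.3 (iii) pp.73–74; ERRATUM
E2 = [IUTchI] Rmk. 3.2.4 (i)(a) [cite: MochizukiEtTh2009, Def 3.3 (iii) p.73].  abc-iut cell, layer L2; FOUNDATIONS row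
«LogDivisorModel v2» (abc-iut-L2-lead R342/R387), part C (parts A `TemperedFilterLevels.lean`, B `LogDivisorTower.lean`);
seat abc-iut-L2-t3 (gen 5).  PROOF-ONLY (0 defs); STAGED with parts A/B, not filed before abc-iut-plan's GO.
* `LogDivisorTower.rootLaw_ofTower_iff` — `DivisorMonoids.RootLaw (ofTower T)` (p449939's data-level E2 (a)) READ ON THE
  TOWER: every `b ∈ B₀(Y) = Hom_Π(Y, Mero(Z_∞^{(lvl Y)}))` has, for every `N`, an `N`-th root in
  `Hom_Π(Y', Mero(Z_∞^{(lvl Y')}))` over some covering `Y' → Y`, AFTER pulling back AND passing to the deeper level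
  `Z_∞^{(lvl Y')} → Z_∞^{(lvl Y)}` — roots may live at deeper levels, which is exactly what the v1 class forbade
  (F-L2t3g5-1).
* `LogDivisorTower.rootLaw_ofTower_ofGaloisAction_iff` — for the ONE-LEVEL tower of a v1 model the tower root law is the
  root law of abc-iut-w6-d048's tempered model of record `ofGaloisActionTempered A hZ` (p449586) — hence collapses there
  (`Sec3RootLawNoGoTempered`, p453110): v2 adds nothing at one level and exactly the level change in general.
HONEST FRAMING: bookkeeping over the staged v2 datum; typed ≠ proved; nothing here bears on [IUTchIII] Cor. 3.12.
-/

noncomputable section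

namespace Literature.AnabelianGeometry.EtaleTheta

open CategoryTheory Opposite Function Literature.AlgebraicGeometry.Frobenioids Literature.AnabelianGeometry.SemiGraphs

universe u

namespace LogDivisorTower

variable {P : Type u} [Group P] [TopologicalSpace P] {L : LevelSystem P} (T : LogDivisorTower P L)

/-- **E2 (a) on the tower datum, unfolded**: `RootLaw (ofTower T)` says every `b ∈ Hom_Π(Y, Mero(Z_∞^{(lvl Y)}))` acquires,
for every `N`, an `N`-th root over some covering `Y' → Y` AT THE LEVEL OF `Y'` (pull back, then change level).
[cite: MochizukiEtTh2009, Def 3.3 (iii) p.73] -/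
theorem rootLaw_ofTower_iff :
    (DivisorMonoids.ofTower T).RootLaw ↔
      ∀ (N : ℕ+) (Y : ConnectedPart (BTemp P)) (b : (T.act (L.lvl Y)).bZero (gset Y)),
        ∃ (Y' : ConnectedPart (BTemp P)) (f : Y' ⟶ Y) (r : (T.act (L.lvl Y')).bZero (gset Y')),
          r ^ (N : ℕ) = T.transB (L.closure_lvl_mono f) (gset Y') ((T.act (L.lvl Y)).bZeroPull f.hom.hom b) := by
  exact ⟨fun h N Y b => h.exists_root N Y b, fun h => ⟨fun N Y b => h N Y b⟩⟩

/-- Values: under `RootLaw (ofTower T)`, every value `b(y) ∈ Mero(Z_∞^{(lvl Y)})` becomes an `N`-th power AFTER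
`resFn` to the deeper level `lvl Y'` — NOT in `Mero(Z_∞^{(lvl Y)})` itself (so Prop. 3.2 (iii) at level `lvl Y` is not
contradicted: contrast `Sec3RootLawNoGoTempered`). [cite: MochizukiEtTh2009, Prop 3.2 (iii) p.70] -/
theorem exists_pow_eq_resFn_apply_of_rootLaw (h : (DivisorMonoids.ofTower T).RootLaw) (N : ℕ+)
    (Y : ConnectedPart (BTemp P)) (b : (T.act (L.lvl Y)).bZero (gset Y)) (y : (gset Y).V) :
    ∃ (Y' : ConnectedPart (BTemp P)) (f : Y' ⟶ Y) (g : (T.Z (L.lvl Y')).Fn),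
      g ^ (N : ℕ) = T.resFn (L.closure_lvl_mono f) (b.1 y) := by
  obtain ⟨Y', f, r, hr⟩ := (T.rootLaw_ofTower_iff).1 h N Y b
  obtain ⟨y', rfl⟩ := QuasiTemperoid.BTempConnected.surjective_of_isConnectedObj
    (QuasiTemperoid.BTempConnected.nonempty_of_isConnectedObj Y'.obj Y'.property).some Y.property f.hom y
  refine ⟨Y', f, r.1 y', ?_⟩
  exact congrArg (fun x : (T.act (L.lvl Y')).bZero (gset Y') => x.1 y') hr

/-- **One-level towers**: the tower root law of `ofGaloisAction A hZ` (v1 model as a one-level tower) is EQUIVALENT to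
the root law of abc-iut-w6-d048's tempered model of record `ofGaloisActionTempered A hZ` (same `B₀(Y) = Hom_Π(Y, Mero(Z_∞))`,
same pull-backs, identity level change). [cite: MochizukiEtTh2009, Def 3.3 (iii) p.73] -/
theorem rootLaw_ofTower_ofGaloisAction_iff {Z : LogDivisorModel.{u}} (A : Z.GaloisAction P) (hZ : Z.CuspLaws) :
    (DivisorMonoids.ofTower (ofGaloisAction A hZ)).RootLaw ↔ (DivisorMonoids.ofGaloisActionTempered A hZ).RootLaw := by
  constructor
  · intro h
    refine ⟨fun N Y b => ?_⟩
    obtain ⟨Y', f, r, hr⟩ := h.exists_root N Y b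
    exact ⟨Y', f, r, hr⟩
  · intro h
    refine ⟨fun N Y b => ?_⟩
    obtain ⟨Y', f, r, hr⟩ := h.exists_root N Y b
    exact ⟨Y', f, r, hr⟩

/-- Hence at one level the tower root law COLLAPSES like the v1 one (`Sec3RootLawNoGoTempered`, p453110): `B₀ = 1`.
[cite: MochizukiEtTh2009, Prop 3.2 (iii) p.70] -/
theorem bZero_eq_one_of_rootLaw_ofTower_ofGaloisAction {Z : LogDivisorModel.{u}} (A : Z.GaloisAction P) (hZ : Z.CuspLaws)
    (h : (DivisorMonoids.ofTower (ofGaloisAction A hZ)).RootLaw) (Y : ConnectedPart (BTemp P))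
    (b : (DivisorMonoids.ofGaloisActionTempered A hZ).B₀.obj (op Y)) : b = 1 :=
  DivisorMonoids.bZero_eq_one_of_rootLaw_ofGaloisActionTempered A hZ ((rootLaw_ofTower_ofGaloisAction_iff A hZ).1 h) Y b

end LogDivisorTower

end Literature.AnabelianGeometry.EtaleTheta

end
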